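import Summits.QuantumFields.YangMills.Theses.BalabanUVNodes
import Summits.QuantumFields.YangMills.Theorems.BalabanUVNodesN27AtKernelPinnedReading13CoPHProducers

/-!
# BalabanUVNodes ∕ N27 = binder B5 AT THE RECORD, leaf (Kᴾ′) — K3⁷ `Theses.BalabanUVNodes.SpineGivenEndpointR13SepCoPH` AT A KERNEL-PINNED STAGE-13 RATE READING WITH **EVERY
# U3-KEYED K4 SLOT IN ITS PRODUCER's LANDED KERNEL CURRENCY**: N22 ⟸ dag-n22-w3's (1.21) passage (p593053: windowed finite-volume joint history-Lipschitz bounds + def-B's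
# `PolLimitExists`), N18 ⟸ dag-n18-w1's family reduction (p593165: + `ω ≤ θ₅` + NE5 at ONE member), (D4) ⟸ print's (5.10) `KernelDecayOfRecord₁₃` (this seat's g0 p591653), N17
# ELIMINATED (module (Kᴾ) `…N27AtKernelPinnedReading13CoPHProducers` §2 by name at `N = 2`, `Rg :=` the item's guard `θ.ZhUnity F 2 ∧ θ.SlotsNondegenerate₁₃ F 2`, through XXXVIᶜᵒᵖᴴ
# `spine_rec13CCoPHOn_iff_forall_guarded` and `hc := hP.toCore` — the producers twin of leaf (K′); a route-facing leaf, nothing may import it)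
# (cell `pub-ymgap`, HUMAN RULING D-0062 Track A; director-ym №197 ∕ HUMAN RULING D-0149; width seat `pub-ymgap-dag-n27-w1` gen 2 on NODE n27 (B5 composite);
# `--kind proof --supports stmt-QuantumFields-20544 --as helper`; COUNT-NEUTRAL)

WHAT IS KERNEL-CHECKED ([bookkeeping]; ONE theorem, 0 `def`, 0 `sorry`): ★★ `spineGivenEndpointR13SepCoPH_holder_of_kernels_pin_of_windowed_member : … → SpineGivenEndpointR13SepCoPH`
— THE ITEM as a term under displayed hypotheses: ANY Stage-13 rate reading `𝔯` with the pin `hpin : (𝔯.lit F θ hP g₀ os).u3 = objectsOfRecord₁₃ F 2 θ.toStage13Params (ℓ F θ)`; N14 ∕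
N15 ∕ N16-at-exponent-β as the stubs at the guarded regime home of `𝔯` (β a LETTER); per guarded admissible tuple: the letter inequalities `(ℓ F θ).Signs`, `0 < κ`, `betaPrime510 4 1
κ ≤ cr`, `ω ≤ θ₅`; `PolLimitExists` of the merged term family of record at every history of the window `]0, θ.γ]^ℕ` and every level; the windowed joint history-Lipschitz bounds
with the moduli of record, eventually in the volume index; NE5 at ONE member `b₀ ∈ ]0, θ.γ]` per run length with constant `C₅ − C₉·θ.γ`; the ONE (5.10) clause
`KernelDecayOfRecord₁₃ F 2 θ.toStage13Params 0 1 (ℓ F θ).κ`; the K5 stubs at the guarded spine home; the spine-side representation `hx`; the N19′ edge `h19` reading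
`RatesHolderAt … β`.

HONEST FRAMING.  NOT a discharge: a term of the item's type under displayed hypotheses (audit `proof.conditional`), each inhabited for no family today (K0⁷ `Record13SepCoPHInhabited`
OPEN); the windowed history-Lipschitz bounds (= NE9 at finite volume, NOT PRINTED for d = 4), the existence of the (1.21) limits ([Balaban1987RG1] p. 264, NOT proved), NE5 at one
member, (5.10) for the limiting kernels (p. 293, NOT proved), NE1′, NE2, NE3 at exponent β, NE7 ∕ NE7b ∕ NE7c are HYPOTHESES; nothing of Bałaban's asserted or instantiated; N27
COMPOSITE, NOT discharged; K3⁷ NOT claimed; route rev 25 and the skeleton of record v2 145a664ea9c38a7b UNTOUCHED; counts UNMOVED (typed 28∕28 · discharged 5∕27, A 5∕28); one finite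
four-torus programme at fixed `ε` — R4 closes the conditional rung `BalabanLadder.UV` only: NOT ℝ⁴, NOT infinite volume, NOT OS, NOT a mass gap, NOT Clay.  No decl below carries
a cite tag.
-/

set_option autoImplicit false

namespace Summit.QuantumFields.YangMills.Theorems.BalabanUVNodesN27SpineRecord

open Filter
open scoped Matrix.Norms.L2Operator
open Literature.MathematicalPhysics.QuantumFieldTheory.Balaban1983to89
open Literature.MathematicalPhysics.QuantumFieldTheory.Balaban1983to89.T4Continuum
open Literature.MathematicalPhysics.QuantumFieldTheory.Balaban1983to89.T4OutputRate (Window NE5)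
open Literature.MathematicalPhysics.QuantumFieldTheory.Balaban1983to89.B12Sec2to5 (betaPrime510 l1)
open Literature.MathematicalPhysics.QuantumFieldTheory.Balaban1983to89.Node00 (polWindow PolLimitExists mergedTermFamilyMatT TβOfRecord₁₃ chiβOfRecord₁₃)
open Literature.MathematicalPhysics.QuantumFieldTheory.Balaban1983to89.Node00.U3OfKernels (histPrefix objectsOfRecord₁₃ KernelDecayOfRecord₁₃)
open T4ContinuumYM4Torus (ForSmallCouplings)
open Summit.QuantumFields.BalabanUV.T4Continuum.Spine
open YMDAG.UVSplit
open Node00 (Stage13HParams datumOfRecord₁₃CoPH U3Letters₁₁)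
open Summit.QuantumFields.YangMills.BalabanUVNodes.N16HolderDefs (S_N16Holder)
open Summit.QuantumFields.YangMills.BalabanUVNodes.SpineRatesHolder (RatesHolderAt)
open Summit.QuantumFields.YangMills.Theses.BalabanUVNodes (SpineGivenEndpointR13SepCoPH)

variable (cr₁₃ : SpineReading₁₃CoPH 2) (β : ℝ) (𝔯 : RateReading₁₃CoPH 2) (ℓ : (F : T4Family) → Stage13HParams F 2 → U3Letters₁₁)

/-- ★★ **K3⁷ AT A KERNEL-PINNED STAGE-13 RATE READING, EVERY U3-KEYED SLOT IN ITS PRODUCER's KERNEL CURRENCY** (`N = 2`; (Kᴾ) §2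
`spine_rec13CCoPHOn_holder_of_kernels_pin_of_windowed_member` at `Rg :=` the item's guard, through `spine_rec13CCoPHOn_iff_forall_guarded`): N22 ⟸ windowed history-Lipschitz bounds +
`PolLimitExists` (dag-n22-w3), N18 ⟸ N22 + `ω ≤ θ₅` + one NE5 member (dag-n18-w1), (D4) ⟸ (5.10) (g0), N17 eliminated, N14 ∕ N15 ∕ N16-at-β stubs, K5, `hx`, the N19′ edge at β —
the guard reaching every θ-keyed hypothesis.  NOT a discharge: a term of the item's type under displayed hypotheses, each inhabited for no family today. [bookkeeping] -/
theorem spineGivenEndpointR13SepCoPH_holder_of_kernels_pin_of_windowed_member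
    (hpin : ∀ (F : T4Family) (θ : Stage13HParams F 2) (hP : θ.Provisos₁₃CoPH F 2) (g₀ : ℕ → ℝ) (os : List (ULoop F)),
      (𝔯.lit F θ hP g₀ os).u3 = objectsOfRecord₁₃ F 2 θ.toStage13Params (ℓ F θ))
    (h14 : S_N14 (RRec₁₃CoPHOn 𝔯 fun F θ => θ.ZhUnity F 2 ∧ θ.SlotsNondegenerate₁₃ F 2))
    (h15 : S_N15 (RRec₁₃CoPHOn 𝔯 fun F θ => θ.ZhUnity F 2 ∧ θ.SlotsNondegenerate₁₃ F 2))
    (h16 : S_N16Holder β (RRec₁₃CoPHOn 𝔯 fun F θ => θ.ZhUnity F 2 ∧ θ.SlotsNondegenerate₁₃ F 2))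
    (hs : ∀ (F : T4Family) (θ : Stage13HParams F 2), θ.Provisos₁₃CoPH F 2 → (θ.ZhUnity F 2 ∧ θ.SlotsNondegenerate₁₃ F 2) → θ.Admissible F 2 → (ℓ F θ).Signs)
    (hκ : ∀ (F : T4Family) (θ : Stage13HParams F 2), θ.Provisos₁₃CoPH F 2 → (θ.ZhUnity F 2 ∧ θ.SlotsNondegenerate₁₃ F 2) → θ.Admissible F 2 → 0 < (ℓ F θ).κ)
    (hcr : ∀ (F : T4Family) (θ : Stage13HParams F 2), θ.Provisos₁₃CoPH F 2 → (θ.ZhUnity F 2 ∧ θ.SlotsNondegenerate₁₃ F 2) → θ.Admissible F 2 →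
      betaPrime510 4 1 (ℓ F θ).κ ≤ (ℓ F θ).cr)
    (hωθ : ∀ (F : T4Family) (θ : Stage13HParams F 2), θ.Provisos₁₃CoPH F 2 → (θ.ZhUnity F 2 ∧ θ.SlotsNondegenerate₁₃ F 2) → θ.Admissible F 2 → (ℓ F θ).ω ≤ (ℓ F θ).θ₅)
    (hlim : ∀ (F : T4Family) (θ : Stage13HParams F 2), θ.Provisos₁₃CoPH F 2 → (θ.ZhUnity F 2 ∧ θ.SlotsNondegenerate₁₃ F 2) → θ.Admissible F 2 →
      letI := θ.instVβ₁; letI := θ.instVβ₂; letI := θ.instιβ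
      ∀ g ∈ Window θ.γ, ∀ j : ℕ,
        PolLimitExists F (j + 1)
          (fun K => mergedTermFamilyMatT F 2 (TβOfRecord₁₃ F 2) (chiβOfRecord₁₃ F 2 θ.toStage13Params) θ.εbg j (histPrefix g j) K) θ.ρ8 θ.bV)
    (hK : ∀ (F : T4Family) (θ : Stage13HParams F 2), θ.Provisos₁₃CoPH F 2 → (θ.ZhUnity F 2 ∧ θ.SlotsNondegenerate₁₃ F 2) → θ.Admissible F 2 →
      letI := θ.instVβ₁; letI := θ.instVβ₂; letI := θ.instιβ
      ∀ g ∈ Window θ.γ, ∀ g' ∈ Window θ.γ, ∀ (j : ℕ) (μ ν : Fin 4) (z : Fin 4 → ℤ), ∀ᶠ K in atTop,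
        |polWindow F K (j + 1)
              (mergedTermFamilyMatT F 2 (TβOfRecord₁₃ F 2) (chiβOfRecord₁₃ F 2 θ.toStage13Params) θ.εbg j (histPrefix g j) K) θ.ρ8 θ.bV μ ν z -
            polWindow F K (j + 1)
              (mergedTermFamilyMatT F 2 (TβOfRecord₁₃ F 2) (chiβOfRecord₁₃ F 2 θ.toStage13Params) θ.εbg j (histPrefix g' j) K) θ.ρ8 θ.bV μ ν z| ≤
          Real.exp (-((ℓ F θ).κ * l1 z)) * ∑ i ∈ Finset.range (j + 1), (ℓ F θ).moduli (j + 1) i * |g i - g' i|)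
    (h5 : ∀ (F : T4Family) (θ : Stage13HParams F 2), θ.Provisos₁₃CoPH F 2 → (θ.ZhUnity F 2 ∧ θ.SlotsNondegenerate₁₃ F 2) → θ.Admissible F 2 → ∀ k : ℕ, ∃ b₀ : ℝ, 0 < b₀ ∧
      b₀ ≤ θ.γ ∧ NE5 ((objectsOfRecord₁₃ F 2 θ.toStage13Params (ℓ F θ)).EA k) ((objectsOfRecord₁₃ F 2 θ.toStage13Params (ℓ F θ)).EB k b₀) (Window θ.γ) (ℓ F θ).κ (ℓ F θ).θ₅
        ((ℓ F θ).C₅ - (ℓ F θ).C₉ * θ.γ))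
    (hdec : ∀ (F : T4Family) (θ : Stage13HParams F 2), θ.Provisos₁₃CoPH F 2 → (θ.ZhUnity F 2 ∧ θ.SlotsNondegenerate₁₃ F 2) → θ.Admissible F 2 →
      KernelDecayOfRecord₁₃ F 2 θ.toStage13Params 0 1 (ℓ F θ).κ)
    (h20 : S_N20 (SRec₁₃CoPHOn cr₁₃ fun F θ => θ.ZhUnity F 2 ∧ θ.SlotsNondegenerate₁₃ F 2)) (h21 : S_N21 (SRec₁₃CoPHOn cr₁₃ fun F θ => θ.ZhUnity F 2 ∧ θ.SlotsNondegenerate₁₃ F 2))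
    (hx : ∀ (F : T4Family) (θ : Stage13HParams F 2) (hP : θ.Provisos₁₃CoPH F 2), (θ.ZhUnity F 2 ∧ θ.SlotsNondegenerate₁₃ F 2) → θ.Admissible F 2 →
      B16.EndStatementBPrinted (datumOfRecord₁₃CoPH F 2 θ hP).C → DagBinding.EndpointExistence (datumOfRecord₁₃CoPH F 2 θ hP).C.toB12 →
        ForSmallCouplings (datumOfRecord₁₃CoPH F 2 θ hP) fun g₀ => ∀ os : List (ULoop F),
          0 < (cr₁₃ F θ hP g₀ os).l₀ ∧ 0 < (cr₁₃ F θ hP g₀ os).vol ∧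
          (∀ (K : ℕ) (t : ℝ), |t| ≤ (cr₁₃ F θ hP g₀ os).l₀ →
            T4GenFunBounds.schemeZ ((datumOfRecord₁₃CoPH F 2 θ hP).scheme g₀) os ((cr₁₃ F θ hP g₀ os).K₀ + K) t =
              ∑ τ ∈ (cr₁₃ F θ hP g₀ os).T K, (cr₁₃ F θ hP g₀ os).A K t τ) ∧
          (∀ (K : ℕ) (t : ℝ), |t| ≤ (cr₁₃ F θ hP g₀ os).l₀ →
            T4GenFunBounds.schemeZ ((datumOfRecord₁₃CoPH F 2 θ hP).scheme g₀) os ((cr₁₃ F θ hP g₀ os).K₀ + K + 1) t =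
              ∑ τ ∈ (cr₁₃ F θ hP g₀ os).T K, (cr₁₃ F θ hP g₀ os).B K t τ))
    (h19 : ∀ (F : T4Family) (θ : Stage13HParams F 2) (hP : θ.Provisos₁₃CoPH F 2), (θ.ZhUnity F 2 ∧ θ.SlotsNondegenerate₁₃ F 2) → θ.Admissible F 2 → ∀ (g₀ : ℕ → ℝ) (os : List (ULoop F)),
      (∀ k : ℕ, RatesHolderAt (datumOfRecord₁₃CoPH F 2 θ hP) (rateCarriersOfRecord₁₃CoPH 𝔯 F θ hP g₀ os k) β) → letI := (cr₁₃ F θ hP g₀ os).dec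
        ∃ δ : ℕ → ℝ, NE7.Core (cr₁₃ F θ hP g₀ os).l₀ (cr₁₃ F θ hP g₀ os).vol (cr₁₃ F θ hP g₀ os).T (cr₁₃ F θ hP g₀ os).Bad
          (fun K t τ => (cr₁₃ F θ hP g₀ os).A K t τ - (cr₁₃ F θ hP g₀ os).shA K t τ) (fun K t τ => (cr₁₃ F θ hP g₀ os).B K t τ - (cr₁₃ F θ hP g₀ os).shB K t τ) δ ∧
          Summable δ) :
    SpineGivenEndpointR13SepCoPH :=
  fun F θ hP hG hθ _ _ =>
    (spine_rec13CCoPHOn_iff_forall_guarded fun F θ => θ.ZhUnity F 2 ∧ θ.SlotsNondegenerate₁₃ F 2).mp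
      (spine_rec13CCoPHOn_holder_of_kernels_pin_of_windowed_member cr₁₃ β 𝔯 (fun F θ => θ.ZhUnity F 2 ∧ θ.SlotsNondegenerate₁₃ F 2) ℓ hpin h14 h15 h16 hs hκ hcr hωθ hlim hK h5
        hdec h20 h21 hx h19)
      F θ hP.toCore hG hθ

end Summit.QuantumFields.YangMills.Theorems.BalabanUVNodesN27SpineRecord
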